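import Mathlib
import Summits.Schanuel.Schanuel.Theorems.RootDecomp1EAnchorToolkit
import Summits.Schanuel.Schanuel.Theses.RootDecomp1E
import Literature.Barriers.Schanuel.LargeTranscendenceDegree
import Literature.NumberTheory.Transcendental.BakerLogarithmsConclusion
import Summits.Schanuel.Schanuel.Theorems.RootDecomp1EMultiplicationTypeLeaves

/-!
# RootDecomp1E — leaves of ROUND 7 «MultiplicationType» (lens 2, gen 7), part 2/4: (a) every E-stable independent span of rank ≥ 3 has trdeg ℚ(z, e^z) ≥ 2 (mod h29 = Thm 2.9)

MONOLITH = `g7/RootDecomp1EMultiplicationTypeLeaves.port.lean` (994 lines, lean check rc0 · 0 · 0 against the live tree 2026-08-30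
≈09:10Z); this is PART 2/4 of its split at section boundaries for the 400-line cap (one namespace
`…Theorems.RootDecomp1EMultiplicationTypeLeaves` across the four modules; part k imports part k−1).  Parts 2–4 typecheck once
their predecessor is in the tree (the monolith is the checked reference).
Target `Summits/Schanuel/Schanuel/Theorems/RootDecomp1EMultiplicationTypeLeavesEStable.lean`, `--supports stmt-Schanuel-31409` (EStableDefectOne; parts 3–4 equally
concern stmt-Schanuel-31410 PlainDefectOne).  See the monolith header for the per-theorem description.
-/

set_option linter.dupNamespace false

noncomputable section

namespace Summit.Schanuel.Schanuel.Theorems.RootDecomp1EMultiplicationTypeLeaves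

open Complex IntermediateField Module Polynomial
open Summit.Schanuel.Schanuel.Theorems.RootDecomp1EAnchor (isAlgebraic_of_mem_adjoin
  trdeg_adjoin_le_of_isAlgebraic mem_adjoin_of_mem_span exp_isAlgebraic_of_mem_span)
open Literature.Barriers.Schanuel (gridField₂ smallTrdeg_thm_2_9_pos smallTrdeg_thm_2_9_two_two
  WaldschmidtConjecture_2_3 trdeg_mono)
open Literature.NumberTheory.Transcendental (baker_holds)
open Summit.Schanuel.Schanuel.Theorems.RootDecomp1EEStableRung (mul_mem_span_of_gens plane mem_plane_self mul_mem_plane_self mul_mem_plane plane_finiteDimensional one_beta_linearIndependent pair_linearIndependent finrank_plane plane_eq_of_mem)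


/-! ## (a) Every E-stable independent span of rank ≥ 3 carries two algebraically independent numbers

`two_le_trdeg_of_eStable` (mod the tree theorem `smallTrdeg_thm_2_9_pos`, T.H.-free Theorem 2.9, t₂-clause with `d = 2`):
if `z` is ℚ-independent of length `n ≥ 3` and `span_ℚ z` is E-STABLE then `trdeg ℚ(z, e^z) ≥ 2`.  Two cases on the
multiplier `β`: if `(v, βv, β²v)` is independent (`v = z₀`) the grid is `x = (1, β)`, `y = (v, βv, β²v)` (`3 + 2 < 6`);
otherwise `β` is QUADRATIC, the span is a `ℚ(β)`-space of rank ≥ 2, and the grid is `x = (1, β)`, `y = (v, βv, w, βw)`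
with `w = z_i` outside the plane `ℚv + ℚβv` (`4 + 2 < 8`; the two `β`-planes meet in `0`).  So an E-stable failure of `S⁻`
never sits at `trdeg = 1`: the E-plane cell of `n = 4` (e.g. `(1, i, π, iπ)`) is exactly one number short of `S⁻`.
The plane toolkit (`plane` … `plane_eq_of_mem`), `one_beta_linearIndependent` and `mul_mem_span_of_gens` are TAKEN FROM
the landed rung `Theorems.RootDecomp1EEStableRung` (opened at the top of this file; no local copies). -/

section EPlane

variable {β : ℂ}

/-- Independence of `(v, βv, w, βw)` when the `β`-planes through `v` and `w` are distinct (`β` quadratic). -/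
theorem biplane_linearIndependent {p q : ℚ} (hβ : β ^ 2 = algebraMap ℚ ℂ p + algebraMap ℚ ℂ q * β)
    (hβq : β ∉ Set.range (algebraMap ℚ ℂ)) {v w : ℂ} (hv : v ≠ 0) (hw : w ≠ 0) (hvw : w ∉ plane β v) :
    LinearIndependent ℚ ![v, β * v, w, β * w] := by
  classical
  haveI := plane_finiteDimensional β v
  haveI := plane_finiteDimensional β w
  -- the two planes meet trivially
  have hinf : plane β v ⊓ plane β w = ⊥ := by
    rw [Submodule.eq_bot_iff]
    intro x hx
    by_contra hx0
    have h1 : plane β x = plane β v := plane_eq_of_mem hβ hβq hv hx.1 hx0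
    have h2 : plane β x = plane β w := plane_eq_of_mem hβ hβq hw hx.2 hx0
    apply hvw
    rw [← h1, h2]
    exact mem_plane_self β w
  have hdim := Submodule.finrank_sup_add_finrank_inf_eq (plane β v) (plane β w)
  rw [hinf, finrank_bot, add_zero, finrank_plane hβq hv, finrank_plane hβq hw] at hdim
  -- the span of the four vectors is the sum of the two planes
  have hspan : Submodule.span ℚ (Set.range ![v, β * v, w, β * w]) = plane β v ⊔ plane β w := by
    apply le_antisymm
    · rw [Submodule.span_le]
      rintro _ ⟨i, rfl⟩
      fin_cases i
      · exact Submodule.mem_sup_left (mem_plane_self β v)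
      · exact Submodule.mem_sup_left (mul_mem_plane_self β v)
      · exact Submodule.mem_sup_right (mem_plane_self β w)
      · exact Submodule.mem_sup_right (mul_mem_plane_self β w)
    · have hg : ∀ k : Fin 4, ![v, β * v, w, β * w] k ∈ Submodule.span ℚ (Set.range ![v, β * v, w, β * w]) :=
        fun k => Submodule.subset_span ⟨k, rfl⟩
      refine sup_le ?_ ?_
      · rw [plane, Submodule.span_le]
        rintro _ ⟨i, rfl⟩
        fin_cases i
        · simpa using hg 0
        · simpa using hg 1
      · rw [plane, Submodule.span_le]
        rintro _ ⟨i, rfl⟩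
        fin_cases i
        · simpa using hg 2
        · simpa using hg 3
  rw [linearIndependent_iff_card_eq_finrank_span, Set.finrank, hspan, hdim]
  simp

end EPlane

/-- A dependent `(v, βv, β²v)` with `v ≠ 0`, `β ∉ ℚ` forces a quadratic equation `β² = p + qβ` over `ℚ`. -/
theorem quadratic_of_not_linearIndependent {β v : ℂ} (hv : v ≠ 0) (hβq : β ∉ Set.range (algebraMap ℚ ℂ))
    (hdep : ¬ LinearIndependent ℚ ![v, β * v, β ^ 2 * v]) :
    ∃ p q : ℚ, β ^ 2 = algebraMap ℚ ℂ p + algebraMap ℚ ℂ q * β := by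
  classical
  obtain ⟨g, hsum, i₀, hi₀⟩ := Fintype.not_linearIndependent_iff.mp hdep
  simp only [Fin.sum_univ_three, Matrix.cons_val_zero, Matrix.cons_val_one, Matrix.head_cons,
    Matrix.cons_val_two, Matrix.tail_cons, Algebra.smul_def] at hsum
  have key : (algebraMap ℚ ℂ (g 0) + algebraMap ℚ ℂ (g 1) * β + algebraMap ℚ ℂ (g 2) * β ^ 2)
      * v = 0 := by
    rw [← hsum]; ring
  have key' : algebraMap ℚ ℂ (g 0) + algebraMap ℚ ℂ (g 1) * β + algebraMap ℚ ℂ (g 2) * β ^ 2 = 0 := by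
    rcases mul_eq_zero.mp key with h | h
    · exact h
    · exact absurd h hv
  by_cases hg2 : g 2 = 0
  · exfalso
    rw [hg2, map_zero, zero_mul, add_zero] at key'
    by_cases hg1 : g 1 = 0
    · rw [hg1, map_zero, zero_mul, add_zero] at key'
      have hg0 : g 0 = 0 := (map_eq_zero_iff _ (algebraMap ℚ ℂ).injective).mp key'
      apply hi₀
      fin_cases i₀ <;> assumption
    · apply hβq
      refine ⟨-g 0 / g 1, ?_⟩
      have h1C : algebraMap ℚ ℂ (g 1) ≠ 0 :=
        (map_ne_zero_iff _ (algebraMap ℚ ℂ).injective).mpr hg1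
      rw [map_div₀, map_neg, div_eq_iff h1C]
      linear_combination -key'
  · have h2C : algebraMap ℚ ℂ (g 2) ≠ 0 := (map_ne_zero_iff _ (algebraMap ℚ ℂ).injective).mpr hg2
    refine ⟨-g 0 / g 2, -g 1 / g 2, ?_⟩
    rw [map_div₀, map_neg, map_div₀, map_neg]
    field_simp
    linear_combination key'

/-- Transport of a `d = 2`, `x = (1, β)` grid bound to `F_z`: if every `y_j` lies in the `β`-stable span of `z`, then
`trdeg gridField₂ (1, β) y ≤ trdeg ℚ(z, e^z)`. -/
theorem trdeg_gridField₂_le_of_mem_span {n l : ℕ} {z : Fin n → ℂ} {β : ℂ} (hβalg : IsAlgebraic ℚ β)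
    (hst : ∀ i, β * z i ∈ Submodule.span ℚ (Set.range z)) {y : Fin l → ℂ}
    (hy : ∀ j, y j ∈ Submodule.span ℚ (Set.range z)) :
    Algebra.trdeg ℚ ↥(gridField₂ ![(1 : ℂ), β] y) ≤
      Algebra.trdeg ℚ ↥(adjoin ℚ (Set.range z ∪ Set.range (cexp ∘ z))) := by
  set F : IntermediateField ℚ ℂ := adjoin ℚ (Set.range z ∪ Set.range (cexp ∘ z)) with hF
  set x : Fin 2 → ℂ := ![(1 : ℂ), β] with hx
  have hxV : ∀ i, ∀ v ∈ Submodule.span ℚ (Set.range z), x i * v ∈ Submodule.span ℚ (Set.range z) := by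
    intro i v hv
    fin_cases i
    · simpa [hx] using hv
    · simpa [hx] using mul_mem_span_of_gens hst hv
  show Algebra.trdeg ℚ ↥(adjoin ℚ (Set.range x ∪ Set.range y ∪
      Set.range (fun p : Fin 2 × Fin l => cexp (x p.1 * y p.2)))) ≤ Algebra.trdeg ℚ ↥F
  apply trdeg_adjoin_le_of_isAlgebraic
  rintro t ((⟨i, rfl⟩ | ⟨j, rfl⟩) | ⟨p, rfl⟩)
  · fin_cases i
    · simpa [hx] using (isAlgebraic_one : IsAlgebraic ℚ (1 : ℂ)).tower_top (L := ↥F)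
    · simpa [hx] using hβalg.tower_top (L := ↥F)
  · exact isAlgebraic_of_mem_adjoin (mem_adjoin_of_mem_span (hy j))
  · exact exp_isAlgebraic_of_mem_span (hxV p.1 _ (hy p.2))

/-- **(a)** Every E-STABLE ℚ-independent span of rank `≥ 3` carries two algebraically independent numbers among
`z, e^z` (mod the tree theorem `smallTrdeg_thm_2_9_pos`; feed `smallTrdeg_thm_2_9_pos_holds`). -/
theorem two_le_trdeg_of_eStable (h29 : smallTrdeg_thm_2_9_pos) {n : ℕ} (hn : 3 ≤ n) (z : Fin n → ℂ)
    (hz : LinearIndependent ℚ z) (β : ℂ) (hβalg : IsAlgebraic ℚ β) (hβq : β ∉ Set.range (algebraMap ℚ ℂ))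
    (hst : ∀ i, β * z i ∈ Submodule.span ℚ (Set.range z)) :
    (2 : Cardinal) ≤ Algebra.trdeg ℚ ↥(adjoin ℚ (Set.range z ∪ Set.range (cexp ∘ z))) := by
  classical
  have hxli : LinearIndependent ℚ ![(1 : ℂ), β] := one_beta_linearIndependent hβq
  set i₀ : Fin n := ⟨0, by omega⟩ with hi₀
  set v : ℂ := z i₀ with hv
  have hv0 : v ≠ 0 := hz.ne_zero i₀
  have hV : ∀ u ∈ Submodule.span ℚ (Set.range z), β * u ∈ Submodule.span ℚ (Set.range z) :=
    fun u hu => mul_mem_span_of_gens hst hu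
  have hvV : v ∈ Submodule.span ℚ (Set.range z) := Submodule.subset_span ⟨i₀, rfl⟩
  by_cases hcub : LinearIndependent ℚ ![v, β * v, β ^ 2 * v]
  · -- grid (2, 3)
    have h2 := (h29 2 3 ![(1 : ℂ), β] ![v, β * v, β ^ 2 * v] (by norm_num) (by norm_num) hxli hcub).2.2
      (by norm_num)
    refine h2.trans (trdeg_gridField₂_le_of_mem_span hβalg hst ?_)
    intro j
    fin_cases j
    · simpa using hvV
    · simpa using hV _ hvV
    · have e : β ^ 2 * v = β * (β * v) := by ring
      simpa [e] using hV _ (hV _ hvV)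
  · -- `β` quadratic: grid (2, 4) on two planes
    obtain ⟨p, q, hβ⟩ := quadratic_of_not_linearIndependent hv0 hβq hcub
    set V : Submodule ℚ ℂ := Submodule.span ℚ (Set.range z) with hVdef
    haveI : FiniteDimensional ℚ ↥V := FiniteDimensional.span_of_finite ℚ (Set.finite_range z)
    haveI := plane_finiteDimensional β v
    have hVrank : finrank ℚ ↥V = n := by
      rw [hVdef, finrank_span_eq_card hz]; simp
    have hex : ∃ i, z i ∉ plane β v := by
      by_contra hall
      have hall' : ∀ i, z i ∈ plane β v := fun i => not_not.mp (not_exists.mp hall i)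
      have hle : V ≤ plane β v := by
        rw [hVdef, Submodule.span_le]
        rintro _ ⟨i, rfl⟩
        exact hall' i
      have := Submodule.finrank_mono hle
      rw [hVrank, finrank_plane hβq hv0] at this
      omega
    obtain ⟨i, hi⟩ := hex
    have hw0 : z i ≠ 0 := hz.ne_zero i
    have hwV : z i ∈ V := Submodule.subset_span ⟨i, rfl⟩
    have hyli : LinearIndependent ℚ ![v, β * v, z i, β * z i] :=
      biplane_linearIndependent hβ hβq hv0 hw0 hi
    have h2 := (h29 2 4 ![(1 : ℂ), β] ![v, β * v, z i, β * z i] (by norm_num) (by norm_num) hxli hyli).2.2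
      (by norm_num)
    refine h2.trans (trdeg_gridField₂_le_of_mem_span hβalg hst ?_)
    intro j
    fin_cases j
    · simpa using hvV
    · simpa using hV _ hvV
    · simpa using hwV
    · simpa using hV _ hwV

/-- **(a′)** `S⁻`-reading: an E-stable failure of `DefectOneSchanuel` never sits at transcendence degree `< 2`; in
particular at `n = 3` this is the node's decided cell again (`3 ≤ 2 + 1`). -/
theorem defectOne_three_of_eStable' (h29 : smallTrdeg_thm_2_9_pos) (z : Fin 3 → ℂ)
    (hz : LinearIndependent ℚ z) (β : ℂ) (hβalg : IsAlgebraic ℚ β) (hβq : β ∉ Set.range (algebraMap ℚ ℂ))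
    (hst : ∀ i, β * z i ∈ Submodule.span ℚ (Set.range z)) :
    ((3 : ℕ) : Cardinal) ≤ Algebra.trdeg ℚ ↥(adjoin ℚ (Set.range z ∪ Set.range (cexp ∘ z))) + 1 := by
  have h := add_le_add (two_le_trdeg_of_eStable h29 le_rfl z hz β hβalg hβq hst) (le_rfl : (1 : Cardinal) ≤ 1)
  have h21 : (2 : Cardinal) + 1 = ((3 : ℕ) : Cardinal) := by norm_num
  rw [h21] at h
  exact h

end Summit.Schanuel.Schanuel.Theorems.RootDecomp1EMultiplicationTypeLeaves

end
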